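import Literature.AlgebraicGeometry.ProjectiveSpace.WellCoveredBipartiteGraphs
import HarnessLib

/-!
# The Crupi–Rinaldo–Terai criterion for very well-covered graphs
# (Mahmoudi–Mousivand–Crupi–Rinaldo–Terai–Yassemi 2011, Prop. 1.1 and Thm. 1.2 (2) ⟺ (3))

Topic `Literature/AlgebraicGeometry/ProjectiveSpace`, namespace
`Literature.AlgebraicGeometry.ProjectiveSpace`. Lane `lit-hodgefound`, seat `lit-hodgefound-p32`,
row gen31-#5. Theorems only (no `def`, no named fact). A corollary of `WellCoveredBipartiteGraphs`
(gen31-#2, § 3: the perfect-matching criterion, valid for arbitrary graphs).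

## The source, as printed

M. Mahmoudi, A. Mousivand, M. Crupi, G. Rinaldo, N. Terai, S. Yassemi, *Vertex decomposability and
regularity of very well-covered graphs*, §1: "A graph `G` is well-covered if it has no isolated
vertices and all the maximal independent sets have the same cardinality. If furthermore two times
this cardinality is equal to `|V(G)|`, the graph is called very well-covered. … It is known that any
graph in this class has perfect matching (see [GV2]). Hence we may assume:
(∗) `V(G) = X ∪ Y`, `X ∩ Y = ∅`, where `X = {x_1, …, x_n}` is a minimal vertex cover of `G` and
`Y = {y_1, …, y_n}` is a maximal independent set of `G` such that `{x_1y_1, …, x_ny_n} ⊂ E(G)`. In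
fact we have the following: **Proposition 1.1.** ([CRT]) Let `G` be a graph with `2n` vertices which
are not isolated and with `ht(I(G)) = n`. We assume the conditions (∗). Then `G` is unmixed (very
well-covered) if and only if the following conditions hold:
(i) if `z_ix_j, y_jx_k ∈ E(G)`, then `z_ix_k ∈ E(G)` for distinct `i,j,k` and for `z_i ∈ {x_i,y_i}`;
(ii) if `x_iy_j ∈ E(G)` then `x_ix_j ∉ E(G)`." ([CRT] = M. Crupi, G. Rinaldo, N. Terai,
*Cohen–Macaulay edge ideals whose height is half of the number of vertices*.)

## Dictionary and what is here

The data (∗) on a finite simple graph `G` (Mathlib `SimpleGraph σ`): two injective families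
`x y : ι → σ` with disjoint images covering `σ` (`∀ v, (∃ i, v = x i) ∨ ∃ i, v = y i`,
`x i ≠ y j`), `Y` independent (`¬ y i ∼ y j`) and the matching edges `x i ∼ y i`. Under (∗) the set
`X` is automatically a vertex cover, indeed a minimal one, `Y` is a maximal independent set,
`α(G) = n = |ι|`, `|V| = 2n`, and there is no isolated vertex (§ 1) — so "unmixed" and "very
well-covered" agree, and `ht I(G) = n` holds (`τ = |V| − α`). Well-covered = all maximal independent
sets (`Maximal (fun A => G.IsIndepSet ↑A)`) have the same cardinality.

* § 1 consequences of (∗) listed above, and the matching `x_i ↔ y_i` as an adjacency involution.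
* § 2 **the neighbourhood condition of the matching criterion (gen31-#2: every neighbour of `v` is
  adjacent to every neighbour of its partner) is equivalent to (i) ∧ (ii)** in the coordinates (∗).
* § 3 **Proposition 1.1: under (∗), `G` is well-covered iff (i) and (ii) hold.**

## References

* [MahmoudiEtAl2011] M. Mahmoudi, A. Mousivand, M. Crupi, G. Rinaldo, N. Terai, S. Yassemi, *Vertex
  decomposability and regularity of very well-covered graphs*, J. Pure Appl. Algebra 215 (2011)
  2473–2480, §1, Prop. 1.1, Thm. 1.2.
* [CrupiRinaldoTerai2011] M. Crupi, G. Rinaldo, N. Terai, *Cohen–Macaulay edge ideal whose height is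
  half of the number of vertices*, Nagoya Math. J. 201 (2011) 117–131 (the original of Prop. 1.1).
* [ZaareNahandi2015] R. Zaare-Nahandi, *Pure simplicial complexes and well-covered graphs*, Cor. 2.4
  (the matching criterion used in the proof).
-/

noncomputable section

open Finset

namespace Literature.AlgebraicGeometry.ProjectiveSpace

variable {σ ι : Type*} [Fintype σ] [DecidableEq σ] [Fintype ι]
variable {G : SimpleGraph σ} {x y : ι → σ}

/-! ### § 1 The conditions (∗) -/

omit [Fintype σ] [DecidableEq σ] [Fintype ι] in
/-- **Under (∗) the matching `x_i ↔ y_i` is an adjacency involution** (a perfect matching).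
[cite: MahmoudiEtAl2011, §1 (∗)] -/
theorem exists_matching_involution_of_star (hcover : ∀ v, (∃ i, v = x i) ∨ ∃ i, v = y i)
    (hxy : ∀ i j, x i ≠ y j) (hx : Function.Injective x) (hy : Function.Injective y)
    (hm : ∀ i, G.Adj (x i) (y i)) :
    ∃ m : σ → σ, (∀ v, m (m v) = v) ∧ (∀ v, G.Adj v (m v)) ∧ (∀ i, m (x i) = y i) ∧
      ∀ i, m (y i) = x i := by
  classical
  set m : σ → σ := fun v => if h : ∃ i, v = x i then y h.choose
    else if h' : ∃ i, v = y i then x h'.choose else v with hmdef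
  have hmx : ∀ i, m (x i) = y i := by
    intro i
    have h : ∃ j, x i = x j := ⟨i, rfl⟩
    have hmi : m (x i) = y h.choose := by rw [hmdef]; exact dif_pos h
    rw [hmi, ← hx h.choose_spec]
  have hmy : ∀ i, m (y i) = x i := by
    intro i
    have h : ¬ ∃ j, y i = x j := fun ⟨j, hj⟩ => hxy j i hj.symm
    have h' : ∃ j, y i = y j := ⟨i, rfl⟩
    have hmi : m (y i) = x h'.choose := by rw [hmdef]; dsimp only; rw [dif_neg h, dif_pos h']
    rw [hmi, ← hy h'.choose_spec]
  refine ⟨m, fun v => ?_, fun v => ?_, hmx, hmy⟩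
  · rcases hcover v with ⟨i, rfl⟩ | ⟨i, rfl⟩
    · rw [hmx, hmy]
    · rw [hmy, hmx]
  · rcases hcover v with ⟨i, rfl⟩ | ⟨i, rfl⟩
    · rw [hmx]
      exact hm i
    · rw [hmy]
      exact (hm i).symm

omit [Fintype σ] [DecidableEq σ] [Fintype ι] in
/-- Under (∗), `X` is a vertex cover (the complement of the independent set `Y`).
[cite: MahmoudiEtAl2011, §1 (∗)] -/
theorem adj_imp_exists_eq_x_of_star (hcover : ∀ v, (∃ i, v = x i) ∨ ∃ i, v = y i)
    (hY : ∀ i j, ¬ G.Adj (y i) (y j)) {u v : σ} (huv : G.Adj u v) :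
    (∃ i, u = x i) ∨ ∃ i, v = x i := by
  rcases hcover u with hu | ⟨i, rfl⟩
  · exact Or.inl hu
  · rcases hcover v with hv | ⟨j, rfl⟩
    · exact Or.inr hv
    · exact absurd huv (hY i j)

omit [Fintype σ] in
/-- **Under (∗), `Y` is a maximal independent set.** [cite: MahmoudiEtAl2011, §1 (∗)] -/
theorem maximal_isIndepSet_image_y_of_star (hcover : ∀ v, (∃ i, v = x i) ∨ ∃ i, v = y i)
    (hY : ∀ i j, ¬ G.Adj (y i) (y j)) (hm : ∀ i, G.Adj (x i) (y i)) :
    Maximal (fun A : Finset σ => G.IsIndepSet ↑A) (univ.image y) := by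
  refine ⟨fun a ha b hb _ hab => ?_, fun A hA hYA => ?_⟩
  · rw [Finset.coe_image] at ha hb
    obtain ⟨i, -, rfl⟩ := ha
    obtain ⟨j, -, rfl⟩ := hb
    exact hY i j hab
  · intro a ha
    by_contra haY
    rcases hcover a with ⟨i, rfl⟩ | ⟨i, rfl⟩
    · have hyi : y i ∈ A := hYA (Finset.mem_image.mpr ⟨i, Finset.mem_univ _, rfl⟩)
      exact hA (Finset.mem_coe.mpr ha) (Finset.mem_coe.mpr hyi) (G.ne_of_adj (hm i)) (hm i)
    · exact haY (Finset.mem_image.mpr ⟨i, Finset.mem_univ _, rfl⟩)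

/-- **Under (∗), `X` is a minimal vertex cover.** [cite: MahmoudiEtAl2011, §1 (∗)] -/
theorem minimal_isVertexCover_image_x_of_star (hcover : ∀ v, (∃ i, v = x i) ∨ ∃ i, v = y i)
    (hxy : ∀ i j, x i ≠ y j) (hY : ∀ i j, ¬ G.Adj (y i) (y j)) (hm : ∀ i, G.Adj (x i) (y i)) :
    Minimal (fun W : Finset σ => G.IsVertexCover ↑W) (univ.image x) := by
  have hc : (univ.image y)ᶜ = univ.image x := by
    ext v
    rw [Finset.mem_compl, Finset.mem_image, Finset.mem_image]
    constructor
    · intro hv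
      rcases hcover v with ⟨i, rfl⟩ | ⟨i, rfl⟩
      · exact ⟨i, Finset.mem_univ _, rfl⟩
      · exact absurd ⟨i, Finset.mem_univ _, rfl⟩ hv
    · rintro ⟨i, -, rfl⟩ ⟨j, -, hji⟩
      exact hxy i j hji.symm
  rw [← hc, ← maximal_isIndepSet_iff_minimal_isVertexCover_compl]
  exact maximal_isIndepSet_image_y_of_star hcover hY hm

omit [DecidableEq σ] in
/-- Under (∗), `|V| = 2n`. [cite: MahmoudiEtAl2011, §1 (∗)] -/
theorem card_eq_two_mul_of_star (hcover : ∀ v, (∃ i, v = x i) ∨ ∃ i, v = y i)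
    (hxy : ∀ i j, x i ≠ y j) (hx : Function.Injective x) (hy : Function.Injective y) :
    Fintype.card σ = 2 * Fintype.card ι := by
  classical
  have hdisj : Disjoint (univ.image x) (univ.image y) := by
    rw [Finset.disjoint_left]
    intro v hvx hvy
    obtain ⟨i, -, rfl⟩ := Finset.mem_image.mp hvx
    obtain ⟨j, -, hji⟩ := Finset.mem_image.mp hvy
    exact hxy i j hji.symm
  have hunion : univ.image x ∪ univ.image y = univ := by
    rw [Finset.eq_univ_iff_forall]
    intro v
    rcases hcover v with ⟨i, rfl⟩ | ⟨i, rfl⟩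
    · exact Finset.mem_union_left _ (Finset.mem_image.mpr ⟨i, Finset.mem_univ _, rfl⟩)
    · exact Finset.mem_union_right _ (Finset.mem_image.mpr ⟨i, Finset.mem_univ _, rfl⟩)
  have h := congrArg Finset.card hunion
  rw [Finset.card_union_of_disjoint hdisj, Finset.card_image_of_injective _ hx,
    Finset.card_image_of_injective _ hy, Finset.card_univ, Finset.card_univ] at h
  omega

omit [DecidableEq σ] in
/-- Under (∗) every independent set has at most `n` elements (it meets each matched pair at most once).
[cite: MahmoudiEtAl2011, §1] -/
theorem card_le_of_isIndepSet_of_star (hcover : ∀ v, (∃ i, v = x i) ∨ ∃ i, v = y i)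
    (hxy : ∀ i j, x i ≠ y j) (hx : Function.Injective x) (hy : Function.Injective y)
    (hm : ∀ i, G.Adj (x i) (y i)) {F : Finset σ} (hF : G.IsIndepSet ↑F) :
    F.card ≤ Fintype.card ι := by
  classical
  obtain ⟨m, hminv, hadj, -, -⟩ := exists_matching_involution_of_star hcover hxy hx hy hm
  have hdisj : Disjoint F (F.image m) := by
    rw [Finset.disjoint_left]
    intro v hv hv'
    obtain ⟨w, hw, rfl⟩ := Finset.mem_image.mp hv'
    exact apply_not_mem_of_mem_of_isIndepSet hadj hF hw hv
  have hle : (F ∪ F.image m).card ≤ Fintype.card σ := Finset.card_le_univ _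
  rw [Finset.card_union_of_disjoint hdisj,
    Finset.card_image_of_injective _ (injective_of_involution hminv),
    card_eq_two_mul_of_star hcover hxy hx hy] at hle
  omega

omit [DecidableEq σ] in
/-- **Under (∗), `α(G) = n`** (so `ht I(G) = |V| − α = n`, and "unmixed" = "very well-covered").
[cite: MahmoudiEtAl2011, §1 and Prop. 1.1] -/
theorem indepNum_eq_card_of_star (hcover : ∀ v, (∃ i, v = x i) ∨ ∃ i, v = y i)
    (hxy : ∀ i j, x i ≠ y j) (hx : Function.Injective x) (hy : Function.Injective y)
    (hY : ∀ i j, ¬ G.Adj (y i) (y j)) (hm : ∀ i, G.Adj (x i) (y i)) :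
    G.indepNum = Fintype.card ι := by
  classical
  apply le_antisymm
  · obtain ⟨S, hS⟩ := G.maximumIndepSet_exists
    rw [← SimpleGraph.maximumIndepSet_card_eq_indepNum S hS]
    exact card_le_of_isIndepSet_of_star hcover hxy hx hy hm hS.isIndepSet
  · have h := (maximal_isIndepSet_image_y_of_star hcover hY hm).1.card_le_indepNum
    rwa [Finset.card_image_of_injective _ hy, Finset.card_univ] at h

omit [DecidableEq σ] in
/-- Under (∗), `τ(G) = n` ("`ht(I(G)) = n`"). [cite: MahmoudiEtAl2011, Prop. 1.1] -/
theorem vertexCoverNum_eq_card_of_star (hcover : ∀ v, (∃ i, v = x i) ∨ ∃ i, v = y i)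
    (hxy : ∀ i j, x i ≠ y j) (hx : Function.Injective x) (hy : Function.Injective y)
    (hY : ∀ i j, ¬ G.Adj (y i) (y j)) (hm : ∀ i, G.Adj (x i) (y i)) :
    G.vertexCoverNum = (Fintype.card ι : ℕ) := by
  classical
  rw [vertexCoverNum_eq_card_sub_indepNum, indepNum_eq_card_of_star hcover hxy hx hy hY hm,
    card_eq_two_mul_of_star hcover hxy hx hy]
  congr 1
  omega

omit [Fintype σ] [DecidableEq σ] [Fintype ι] in
/-- Under (∗) no vertex is isolated. [cite: MahmoudiEtAl2011, Prop. 1.1] -/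
theorem exists_adj_of_star (hcover : ∀ v, (∃ i, v = x i) ∨ ∃ i, v = y i)
    (hm : ∀ i, G.Adj (x i) (y i)) (v : σ) : ∃ w, G.Adj v w := by
  rcases hcover v with ⟨i, rfl⟩ | ⟨i, rfl⟩
  · exact ⟨y i, hm i⟩
  · exact ⟨x i, (hm i).symm⟩

/-! ### § 2 The matching criterion in the coordinates (∗) -/

omit [Fintype σ] [DecidableEq σ] [Fintype ι] in
/-- **The neighbourhood condition of the matching `x_i ↔ y_i` (every neighbour of `v` adjacent to
every neighbour of its partner) is equivalent to the Crupi–Rinaldo–Terai conditions (i) and (ii).**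
[cite: MahmoudiEtAl2011, Prop. 1.1] [cite: ZaareNahandi2015, Cor. 2.4] -/
theorem matching_condition_iff_crt (hcover : ∀ v, (∃ i, v = x i) ∨ ∃ i, v = y i)
    (hY : ∀ i j, ¬ G.Adj (y i) (y j)) (hm : ∀ i, G.Adj (x i) (y i))
    {m : σ → σ} (hmx : ∀ i, m (x i) = y i) (hmy : ∀ i, m (y i) = x i) :
    (∀ v u w, G.Adj v u → G.Adj (m v) w → G.Adj u w) ↔
      ((∀ i j k, i ≠ j → j ≠ k → i ≠ k → G.Adj (x i) (x j) → G.Adj (y j) (x k) → G.Adj (x i) (x k)) ∧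
        (∀ i j k, i ≠ j → j ≠ k → i ≠ k → G.Adj (y i) (x j) → G.Adj (y j) (x k) →
          G.Adj (y i) (x k)) ∧
        ∀ i j, G.Adj (x i) (y j) → ¬ G.Adj (x i) (x j)) := by
  constructor
  · intro h
    refine ⟨fun i j k _ _ _ h1 h2 => ?_, fun i j k _ _ _ h1 h2 => ?_, fun i j h1 h2 => ?_⟩
    · exact h (x j) (x i) (x k) h1.symm (by rw [hmx]; exact h2)
    · exact h (x j) (y i) (x k) h1.symm (by rw [hmx]; exact h2)
    · exact G.irrefl (h (x j) (x i) (x i) h2.symm (by rw [hmx]; exact h1.symm))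
  · rintro ⟨hxx, hyx, hii⟩
    -- the case `v = x j`; the case `v = y j` follows by symmetry
    have key : ∀ j u w, G.Adj (x j) u → G.Adj (y j) w → G.Adj u w := by
      intro j u w hu hw
      -- `w` is some `x k` (as `Y` is independent)
      obtain ⟨k, rfl⟩ : ∃ k, w = x k := by
        rcases hcover w with hw' | ⟨k, rfl⟩
        · exact hw'
        · exact absurd hw (hY j k)
      rcases hcover u with ⟨i, rfl⟩ | ⟨i, rfl⟩
      · -- `u = x i`
        have hij : i ≠ j := fun h => G.irrefl (h ▸ hu)
        by_cases hkj : k = j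
        · subst hkj
          exact hu.symm
        by_cases hik : i = k
        · subst hik
          exact absurd hu.symm (hii i j hw.symm)
        exact hxx i j k hij (Ne.symm hkj) hik hu.symm hw
      · -- `u = y i`
        by_cases hij : i = j
        · subst hij
          exact hw
        by_cases hkj : k = j
        · subst hkj
          exact hu.symm
        by_cases hki : k = i
        · subst hki
          exact (hm k).symm
        exact hyx i j k hij (Ne.symm hkj) (Ne.symm hki) hu.symm hw
    intro v u w hu hw
    rcases hcover v with ⟨j, rfl⟩ | ⟨j, rfl⟩
    · rw [hmx] at hw
      exact key j u w hu hw
    · rw [hmy] at hw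
      exact (key j w u hw hu).symm

/-! ### § 3 Proposition 1.1 -/

omit [DecidableEq σ] in
/-- **Proposition 1.1 (Crupi–Rinaldo–Terai).** Under (∗), `G` is unmixed (equivalently very
well-covered) iff (i) `z_ix_j, y_jx_k ∈ E ⟹ z_ix_k ∈ E` for distinct `i,j,k`, `z_i ∈ {x_i, y_i}`, and
(ii) `x_iy_j ∈ E ⟹ x_ix_j ∉ E`. [cite: MahmoudiEtAl2011, Prop. 1.1 and Thm. 1.2]
[cite: CrupiRinaldoTerai2011] -/
theorem wellCovered_iff_crt (hcover : ∀ v, (∃ i, v = x i) ∨ ∃ i, v = y i)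
    (hxy : ∀ i j, x i ≠ y j) (hx : Function.Injective x) (hy : Function.Injective y)
    (hY : ∀ i j, ¬ G.Adj (y i) (y j)) (hm : ∀ i, G.Adj (x i) (y i)) :
    (∀ F F' : Finset σ, Maximal (fun A : Finset σ => G.IsIndepSet ↑A) F →
        Maximal (fun A : Finset σ => G.IsIndepSet ↑A) F' → F.card = F'.card) ↔
      ((∀ i j k, i ≠ j → j ≠ k → i ≠ k → G.Adj (x i) (x j) → G.Adj (y j) (x k) → G.Adj (x i) (x k)) ∧
        (∀ i j k, i ≠ j → j ≠ k → i ≠ k → G.Adj (y i) (x j) → G.Adj (y j) (x k) →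
          G.Adj (y i) (x k)) ∧
        ∀ i j, G.Adj (x i) (y j) → ¬ G.Adj (x i) (x j)) := by
  classical
  obtain ⟨m, hminv, hadj, hmx, hmy⟩ := exists_matching_involution_of_star hcover hxy hx hy hm
  rw [← matching_condition_iff_crt hcover hY hm hmx hmy]
  constructor
  · intro hwc
    refine matching_condition_of_two_mul_card_eq (fun F hF => ?_) hminv hadj
    rw [(wellCovered_iff_forall_card_eq_indepNum G).mp hwc F hF,
      indepNum_eq_card_of_star hcover hxy hx hy hY hm, card_eq_two_mul_of_star hcover hxy hx hy]
  · exact wellCovered_of_matching hminv hadj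

omit [DecidableEq σ] in
/-- Under (∗) and (i), (ii), every maximal independent set has exactly `n` elements.
[cite: MahmoudiEtAl2011, Prop. 1.1] -/
theorem card_eq_of_maximal_isIndepSet_of_crt (hcover : ∀ v, (∃ i, v = x i) ∨ ∃ i, v = y i)
    (hxy : ∀ i j, x i ≠ y j) (hx : Function.Injective x) (hy : Function.Injective y)
    (hY : ∀ i j, ¬ G.Adj (y i) (y j)) (hm : ∀ i, G.Adj (x i) (y i))
    (hxx : ∀ i j k, i ≠ j → j ≠ k → i ≠ k → G.Adj (x i) (x j) → G.Adj (y j) (x k) → G.Adj (x i) (x k))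
    (hyx : ∀ i j k, i ≠ j → j ≠ k → i ≠ k → G.Adj (y i) (x j) → G.Adj (y j) (x k) → G.Adj (y i) (x k))
    (hii : ∀ i j, G.Adj (x i) (y j) → ¬ G.Adj (x i) (x j))
    {F : Finset σ} (hF : Maximal (fun A : Finset σ => G.IsIndepSet ↑A) F) :
    F.card = Fintype.card ι := by
  have hwc := (wellCovered_iff_crt hcover hxy hx hy hY hm).mpr ⟨hxx, hyx, hii⟩
  rw [(wellCovered_iff_forall_card_eq_indepNum G).mp hwc F hF,
    indepNum_eq_card_of_star hcover hxy hx hy hY hm]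

/-! ### § 4 Example: `K_{3,3}` in the coordinates (∗) -/

/-- **`K_{3,3}`** on `Fin 6` (parts `{0,1,2}`, `{3,4,5}`) with `x = (0,1,2)`, `y = (3,4,5)`: the matching
edges `x_iy_i` and the independence of `Y`. [cite: MahmoudiEtAl2011, §1 (∗)] (example) -/
example : (∀ i : Fin 3, (SimpleGraph.fromRel (fun a b : Fin 6 => (a : ℕ) < 3 ∧ 3 ≤ (b : ℕ))).Adj
      ((![0, 1, 2] : Fin 3 → Fin 6) i) ((![3, 4, 5] : Fin 3 → Fin 6) i)) ∧
    ∀ i j : Fin 3, ¬ (SimpleGraph.fromRel (fun a b : Fin 6 => (a : ℕ) < 3 ∧ 3 ≤ (b : ℕ))).Adj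
      ((![3, 4, 5] : Fin 3 → Fin 6) i) ((![3, 4, 5] : Fin 3 → Fin 6) j) := by
  decide

/-- `K_{3,3}` satisfies condition (i) with `z_i = x_i` (vacuously: `X` is independent).
[cite: MahmoudiEtAl2011, Prop. 1.1] (example) -/
example : ∀ i j k : Fin 3, i ≠ j → j ≠ k → i ≠ k →
    (SimpleGraph.fromRel (fun a b : Fin 6 => (a : ℕ) < 3 ∧ 3 ≤ (b : ℕ))).Adj
      ((![0, 1, 2] : Fin 3 → Fin 6) i) ((![0, 1, 2] : Fin 3 → Fin 6) j) →
    (SimpleGraph.fromRel (fun a b : Fin 6 => (a : ℕ) < 3 ∧ 3 ≤ (b : ℕ))).Adj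
      ((![3, 4, 5] : Fin 3 → Fin 6) j) ((![0, 1, 2] : Fin 3 → Fin 6) k) →
    (SimpleGraph.fromRel (fun a b : Fin 6 => (a : ℕ) < 3 ∧ 3 ≤ (b : ℕ))).Adj
      ((![0, 1, 2] : Fin 3 → Fin 6) i) ((![0, 1, 2] : Fin 3 → Fin 6) k) := by
  decide

/-- `K_{3,3}` satisfies condition (i) with `z_i = y_i` (non-vacuously: `y_ix_j, y_jx_k ∈ E` always, and
indeed `y_ix_k ∈ E`). [cite: MahmoudiEtAl2011, Prop. 1.1] (example) -/
example : ∀ i j k : Fin 3, i ≠ j → j ≠ k → i ≠ k →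
    (SimpleGraph.fromRel (fun a b : Fin 6 => (a : ℕ) < 3 ∧ 3 ≤ (b : ℕ))).Adj
      ((![3, 4, 5] : Fin 3 → Fin 6) i) ((![0, 1, 2] : Fin 3 → Fin 6) j) →
    (SimpleGraph.fromRel (fun a b : Fin 6 => (a : ℕ) < 3 ∧ 3 ≤ (b : ℕ))).Adj
      ((![3, 4, 5] : Fin 3 → Fin 6) j) ((![0, 1, 2] : Fin 3 → Fin 6) k) →
    (SimpleGraph.fromRel (fun a b : Fin 6 => (a : ℕ) < 3 ∧ 3 ≤ (b : ℕ))).Adj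
      ((![3, 4, 5] : Fin 3 → Fin 6) i) ((![0, 1, 2] : Fin 3 → Fin 6) k) := by
  decide

/-- `K_{3,3}` satisfies condition (ii) (`x_iy_j ∈ E` always, `x_ix_j ∉ E` always); by Proposition 1.1
it is (very) well-covered, as a complete bipartite graph with equal parts should be.
[cite: MahmoudiEtAl2011, Prop. 1.1] (example) -/
example : ∀ i j : Fin 3,
    (SimpleGraph.fromRel (fun a b : Fin 6 => (a : ℕ) < 3 ∧ 3 ≤ (b : ℕ))).Adj
      ((![0, 1, 2] : Fin 3 → Fin 6) i) ((![3, 4, 5] : Fin 3 → Fin 6) j) →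
    ¬ (SimpleGraph.fromRel (fun a b : Fin 6 => (a : ℕ) < 3 ∧ 3 ≤ (b : ℕ))).Adj
      ((![0, 1, 2] : Fin 3 → Fin 6) i) ((![0, 1, 2] : Fin 3 → Fin 6) j) := by
  decide

end Literature.AlgebraicGeometry.ProjectiveSpace
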